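import Summits.QuantumAdvantage.AdviceFreeQNC0.FibreDecimation37F4
import Summits.QuantumAdvantage.AdviceFreeQNC0.FibreDecimation37Coset
import Summits.QuantumAdvantage.AdviceFreeQNC0.FibreDecimation37Laws
import HarnessLib

/-!
# Cell qa-qnc0, `p = 3` — ROUND-37P2 File B: Lemma 37.D, the DECIMATION IDENTITY (dual-basis functional `L_a` applied to
# the fibre parity on an `m`-subcube coset)

Planner qa-qnc0-p2 g37, ROUND-37P2 §2 Lemma 37.D (i)–(iii), in the kernel.  Setting on the `m` chosen coins `M`:
pattern `a ∈ {1,2}^M` (the letters of the dense test `k₀`), restricted directions `δ_k ∈ 𝔽₃^M` (`k ∈ Fin s`), the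
`M`-part `T ⊆ M` of an `𝔽₂`-affine target, coset parity `ε`.  For residues `ρ ∈ 𝔽₃^s` and a constant `b ∈ 𝔽₂ ⊂ 𝔽₄` the
fibre function is `g_{ρ,b}(w) = Σ_k [⟨δ_k,w⟩ + ρ_k ≢ 0] + Σ_{i∈T} w_i + b ∈ 𝔽₄` (`gfun`).

* `Lfun_gfun_mul_cosetInd` — STRUCTURE: `L_a(g_{ρ,b}·1_{H_ε}) = Σ_k (ω^{ρ_k} A_k + ω^{2ρ_k} B_k) + C + b·U` with
  `A_k = L_a(χ_{δ_k} 1_H)`, `B_k = L_a(χ_{−δ_k} 1_H)` (`coefA`), `C = L_a((Σ_{i∈T} w_i) 1_H)` (`coefC`), `U = L_a(1_H)` (`coefU`)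
  (first line of the proof of 37.D: `[t ≢ 0] = tr(ω^t) = ω^t + ω^{2t}`, `χ_δ² = χ_{−δ}`, linearity of `L_a`);
* `coefA_expand` — `L_a(χ_δ 1_H) = α L_a(χ_δ) + ω Σ_i L_a(χ_{δ+e_i})`, `α = 1 + ε + mω` (`indicator_coset_eq`); hence
  `coefA_eq_zero_of_incompatible` (all of `δ`, `δ + e_i` incompatible ⇒ `A = 0`), `coefA_zero` (blind test: `A = B = U`),
  `coefU_eq` (`U = L_a(1)·(1 + ε + n₁ + mω)`, `n₁ = #{i : a_i = 1}`), `coefA_pattern` (`A_{k₀} = 1 + ε + n₂ + mω`),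
  `coefA_neg_pattern` (`B_{k₀} = 0`, needs `m ≥ 2`);
* the DECODED TESTS `psi θ A B t = tr(θ(ω^t A + ω^{2t} B)) ∈ {0,1}` and **Lemma 37.D**: `decimation_identity` ((i)+(iii): if
  `g_{ρ,b}·1_H ≡ 0` then `Σ_k ψ_k(ρ_k) = c₀ := tr(θ C)` for any `θ` with `θU = 1`), `psi_blind` / `psi_eq_zero_of_not_JCond`
  (tests outside the decimated set vanish identically), `psi_pattern_nonconst` ((ii): `ψ_{k₀}` is a genuine test, `m` odd, `m ≥ 2`),
  `isUnit_coefU` (`U` is a unit for `m` odd, so `θ = U⁻¹` exists: `theta`, `theta_mul_coefU`).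

WHAT THIS IS NOT: the Markov/gluing step and the character-sum step of Theorem 37.F′ are in the sequel files; crux 22907 untouched.
-/

noncomputable section

namespace Summit.QuantumAdvantage.AdviceFreeQNC0.Exp37

open Finset
open Summit.QuantumAdvantage.AdviceFreeQNC0 F4

variable {m s : ℕ}

/-! ### The fibre function and its coefficients -/

/-- `⟨δ, w⟩ = Σ_{i : w_i} δ_i ∈ 𝔽₃`. -/
def dotM (δ : Fin m → ZMod 3) (w : Fin m → Bool) : ZMod 3 := ∑ i, if w i then δ i else 0

/-- The MOD-3 test `[⟨δ,w⟩ + ρ ≢ 0]` as an element of `𝔽₄`. -/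
def testF (δ : Fin m → ZMod 3) (ρ : ZMod 3) (w : Fin m → Bool) : F4 :=
  if dotM δ w + ρ ≠ 0 then 1 else 0

/-- The fibre function `g_{ρ,b}(w) = Σ_k [⟨δ_k,w⟩ + ρ_k ≢ 0] + Σ_{i ∈ T} w_i + b` (in `𝔽₄`; a sum of `0/1` values). -/
def gfun (δ : Fin s → Fin m → ZMod 3) (T : Finset (Fin m)) (ρ : Fin s → ZMod 3) (b : F4)
    (w : Fin m → Bool) : F4 :=
  (∑ k, testF (δ k) (ρ k) w) + (∑ i ∈ T, ιF (w i)) + b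

/-- `A(δ) = L_a(χ_δ · 1_{H_ε})` (so `A_k = A(δ_k)`, `B_k = A(−δ_k)`). -/
def coefA (a : Fin m → Bool) (ε : ℕ) (δ : Fin m → ZMod 3) : F4 :=
  Lfun a (fun w => chiDir δ w * cosetInd ε w)

/-- `C = L_a((Σ_{i∈T} w_i) · 1_{H_ε})`. -/
def coefC (a : Fin m → Bool) (ε : ℕ) (T : Finset (Fin m)) : F4 :=
  Lfun a (fun w => (∑ i ∈ T, ιF (w i)) * cosetInd ε w)

/-- `U = L_a(1_{H_ε})`. -/
def coefU (a : Fin m → Bool) (ε : ℕ) : F4 := Lfun a (fun w => cosetInd ε w)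

/-- `[⟨δ,w⟩ + ρ ≢ 0] = ω^ρ χ_δ(w) + ω^{2ρ} χ_{−δ}(w)` (`tr x = x + x²`, Frobenius). -/
theorem testF_eq (δ : Fin m → ZMod 3) (ρ : ZMod 3) (w : Fin m → Bool) :
    testF δ ρ w = ω ^ ρ.val * chiDir δ w + ω ^ (2 * ρ.val) * chiDir (-δ) w := by
  unfold testF dotM
  rw [test_eq_tr δ ρ w]
  unfold tr
  rw [mul_pow, chiDir_sq, ← pow_mul, mul_comm ρ.val 2]

/-- **STRUCTURE of `L_a(g_{ρ,b} · 1_H)`**: `Σ_k (ω^{ρ_k} A_k + ω^{2ρ_k} B_k) + C + b·U`. -/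
theorem Lfun_gfun_mul_cosetInd (a : Fin m → Bool) (ε : ℕ) (δ : Fin s → Fin m → ZMod 3) (T : Finset (Fin m))
    (ρ : Fin s → ZMod 3) (b : F4) :
    Lfun a (fun w => gfun δ T ρ b w * cosetInd ε w) =
      (∑ k, (ω ^ (ρ k).val * coefA a ε (δ k) + ω ^ (2 * (ρ k).val) * coefA a ε (-δ k))) +
        coefC a ε T + b * coefU a ε := by
  have e : (fun w => gfun δ T ρ b w * cosetInd ε w) =
      fun w => ((∑ k, (ω ^ (ρ k).val * (chiDir (δ k) w * cosetInd ε w) +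
                  ω ^ (2 * (ρ k).val) * (chiDir (-δ k) w * cosetInd ε w))) +
                (∑ i ∈ T, ιF (w i)) * cosetInd ε w) + b * cosetInd ε w := by
    funext w
    unfold gfun
    rw [add_mul, add_mul, Finset.sum_mul]
    congr 2
    refine Finset.sum_congr rfl fun k _ => ?_
    rw [testF_eq]; ring
  rw [e, Lfun_add_fun, Lfun_add_fun, Lfun_sum_fun, Lfun_const_mul]
  unfold coefA coefC coefU
  congr 2
  refine Finset.sum_congr rfl fun k _ => ?_
  rw [Lfun_add_fun, Lfun_const_mul, Lfun_const_mul]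

/-! ### Evaluating the coefficients with Lemma 37.D0 -/

/-- `L_a(χ_δ · 1_{H_ε}) = (1 + ε + mω)·L_a(χ_δ) + ω·Σ_i L_a(χ_{δ + e_i})`. -/
theorem coefA_expand (a : Fin m → Bool) (ε : ℕ) (δ : Fin m → ZMod 3) :
    coefA a ε δ = (1 + (ε : F4) + (m : F4) * ω) * Lfun a (chiDir δ) +
      ω * ∑ i : Fin m, Lfun a (chiDir (δ + Pi.single i 1)) := by
  unfold coefA
  have e : (fun w => chiDir δ w * cosetInd ε w) =
      fun w => (1 + (ε : F4) + (m : F4) * ω) * chiDir δ w +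
        ω * ∑ i : Fin m, chiDir (δ + Pi.single i 1) w := by
    funext w
    rw [indicator_coset_eq, mul_add, mul_comm (chiDir δ w) (1 + (ε : F4) + (m : F4) * ω), Finset.mul_sum,
      Finset.mul_sum, Finset.mul_sum]
    congr 1
    refine Finset.sum_congr rfl fun i _ => ?_
    rw [← chiDir_add]; ring
  rw [e, Lfun_add_fun, Lfun_const_mul, Lfun_const_mul, Lfun_sum_fun]

/-- `L_a(1) = ∏_i ω^{lett(a_i)}` (Lemma 37.D0 at `δ = 0`). -/
theorem Lfun_one_eq (a : Fin m → Bool) : Lfun a (fun _ => (1 : F4)) = ∏ i : Fin m, ω ^ lett (a i) := by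
  classical
  have h := lfunChiDirLaw m a 0
  have e : chiDir (0 : Fin m → ZMod 3) = fun _ => (1 : F4) := funext fun w => chiDir_zero w
  rw [e] at h
  have hc : Compatible a (0 : Fin m → ZMod 3) := fun i hi => absurd rfl hi
  rw [h, if_pos hc]
  refine Finset.prod_congr ?_ fun i _ => rfl
  ext i; simp

/-- `L_a(1)` is a unit. -/
theorem isUnit_Lfun_one (a : Fin m → Bool) : IsUnit (Lfun a (fun _ => (1 : F4))) := by
  rw [Lfun_one_eq]
  exact IsUnit.prod_univ_iff.2 fun i => isUnit_omega_pow _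

/-- The character of an INCOMPATIBLE direction is killed by `L_a`. -/
theorem Lfun_chiDir_eq_zero {a : Fin m → Bool} {δ : Fin m → ZMod 3} (h : ¬ Compatible a δ) :
    Lfun a (chiDir δ) = 0 := by
  rw [lfunChiDirLaw m a δ, if_neg h]

/-- **Incompatible tests are invisible**: if `δ` and every `δ + e_i` are incompatible then `A(δ) = 0`. -/
theorem coefA_eq_zero_of_incompatible {a : Fin m → Bool} (ε : ℕ) {δ : Fin m → ZMod 3}
    (h0 : ¬ Compatible a δ) (h1 : ∀ i, ¬ Compatible a (δ + Pi.single i 1)) : coefA a ε δ = 0 := by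
  rw [coefA_expand, Lfun_chiDir_eq_zero h0, mul_zero, zero_add]
  rw [Finset.sum_eq_zero fun i _ => Lfun_chiDir_eq_zero (h1 i), mul_zero]

/-- **Blind tests**: `A(0) = U`. -/
theorem coefA_zero (a : Fin m → Bool) (ε : ℕ) : coefA a ε (0 : Fin m → ZMod 3) = coefU a ε := by
  unfold coefA coefU
  congr 1
  funext w
  rw [chiDir_zero, one_mul]

/-- `L_a(χ_{e_i}) = [a_i = 1]·ω²·L_a(1)` (compatible iff the letter `a_i` is `1`; then the missing factor is `ω = ω^{-2}`). -/
theorem Lfun_chiDir_single (a : Fin m → Bool) (i : Fin m) :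
    Lfun a (chiDir (Pi.single i (1 : ZMod 3))) =
      if a i = false then ω ^ 2 * Lfun a (fun _ => (1 : F4)) else 0 := by
  classical
  rw [lfunChiDirLaw m a _]
  by_cases hai : a i = false
  · have hc : Compatible a (Pi.single i (1 : ZMod 3)) := by
      intro j hj
      by_cases hji : j = i
      · subst hji; rw [Pi.single_eq_same, hai]; decide
      · rw [Pi.single_eq_of_ne hji] at hj; exact absurd rfl hj
    rw [if_pos hc, if_pos hai, Lfun_one_eq]
    have hfilter : (univ.filter fun j : Fin m => (Pi.single i (1 : ZMod 3) : Fin m → ZMod 3) j = 0) = univ.erase i := by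
      ext j
      simp only [Finset.mem_filter, Finset.mem_univ, true_and, Finset.mem_erase, and_true]
      by_cases hji : j = i
      · subst hji; rw [Pi.single_eq_same]; simp
      · rw [Pi.single_eq_of_ne hji]; simp [hji]
    rw [hfilter, ← Finset.mul_prod_erase univ (fun j => ω ^ lett (a j)) (Finset.mem_univ i), hai]
    unfold lett
    simp only [Bool.false_eq_true, if_false, pow_one]
    rw [← mul_assoc, ← pow_succ, omega_pow_mod 3]
    simp
  · have hc : ¬ Compatible a (Pi.single i (1 : ZMod 3)) := by
      intro hc
      have h := hc i (by rw [Pi.single_eq_same]; decide)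
      rw [Pi.single_eq_same] at h
      rw [Bool.not_eq_false] at hai
      rw [hai] at h
      exact absurd h (by decide)
    rw [if_neg hc, if_neg hai]

/-- `n₁(a) = #{i : a_i = 1}` (letter `1` is coded `false`). -/
def nOne (a : Fin m → Bool) : ℕ := (univ.filter fun i => a i = false).card
/-- `n₂(a) = #{i : a_i = 2}`. -/
def nTwo (a : Fin m → Bool) : ℕ := (univ.filter fun i => a i = true).card

/-- **`U = L_a(1_H) = L_a(1)·(1 + ε + n₁ + mω)`.** -/
theorem coefU_eq (a : Fin m → Bool) (ε : ℕ) :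
    coefU a ε = Lfun a (fun _ => (1 : F4)) * (((1 + ε + nOne a : ℕ) : F4) + (m : F4) * ω) := by
  classical
  rw [← coefA_zero, coefA_expand]
  have e0 : chiDir (0 : Fin m → ZMod 3) = fun _ => (1 : F4) := funext fun w => chiDir_zero w
  simp only [zero_add]
  rw [e0, Finset.sum_congr rfl fun i _ => Lfun_chiDir_single a i, Finset.sum_ite, Finset.sum_const_zero, add_zero,
    Finset.sum_const]
  unfold nOne
  rw [nsmul_eq_mul]
  push_cast
  have h3 : ω * ω ^ 2 = 1 := by rw [← pow_succ', omega_pow_mod 3]; simp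
  linear_combination ((univ.filter fun i => a i = false).card : F4) * Lfun a (fun _ => (1 : F4)) * h3

/-- **`U` is a unit** when `m` is odd (`mω = ω`, and `n + ω ∈ {ω, ω²}`). -/
theorem isUnit_coefU (a : Fin m → Bool) (ε : ℕ) (hm : Odd m) : IsUnit (coefU a ε) := by
  rw [coefU_eq]
  have hm1 : (m : F4) = 1 := by
    rw [natCast_eq, if_pos (Nat.odd_iff.mp hm)]
  rw [hm1, one_mul]
  exact (isUnit_Lfun_one a).mul (isUnit_natCast_add_omega _)

/-- The pattern direction `δ_{k₀} = (lett a_i)_i` is compatible. -/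
theorem compatible_pattern (a : Fin m → Bool) : Compatible a (fun i => lettZ (a i)) := fun _ _ => rfl

/-- **`A_{k₀} = 1 + ε + n₂ + mω`** for the pattern direction. -/
theorem coefA_pattern (a : Fin m → Bool) (ε : ℕ) :
    coefA a ε (fun i => lettZ (a i)) = ((1 + ε + nTwo a : ℕ) : F4) + (m : F4) * ω := by
  classical
  rw [coefA_expand]
  -- `L_a(χ_{δ_{k₀}}) = 1`
  have h1 : Lfun a (chiDir fun i => lettZ (a i)) = 1 := by
    rw [lfunChiDirLaw m a _, if_pos (compatible_pattern a)]
    refine Finset.prod_eq_one fun i hi => ?_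
    rw [Finset.mem_filter] at hi
    exact absurd hi.2 (lettZ_ne_zero _)
  -- `L_a(χ_{δ_{k₀} + e_i}) = [a_i = 2]·ω²`
  have l1 : lettZ false = 1 := by decide
  have l2 : lettZ true = 2 := by decide
  have h2 : ∀ i : Fin m, Lfun a (chiDir ((fun j => lettZ (a j)) + Pi.single i 1)) =
      if a i = true then ω ^ 2 else 0 := by
    intro i
    rw [lfunChiDirLaw m a _]
    by_cases hai : a i = true
    · have hc : Compatible a ((fun j => lettZ (a j)) + Pi.single i 1) := by
        intro j hj
        by_cases hji : j = i
        · subst hji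
          exfalso; apply hj
          rw [Pi.add_apply, Pi.single_eq_same, hai, l2]; decide
        · rw [Pi.add_apply, Pi.single_eq_of_ne hji, add_zero]
      rw [if_pos hc, if_pos hai]
      have hfilter : (univ.filter fun j : Fin m =>
          ((fun j => lettZ (a j)) + Pi.single i (1 : ZMod 3) : Fin m → ZMod 3) j = 0) = {i} := by
        ext j
        simp only [Finset.mem_filter, Finset.mem_univ, true_and, Finset.mem_singleton]
        by_cases hji : j = i
        · subst hji
          rw [Pi.add_apply, Pi.single_eq_same, hai, l2]
          simp only [iff_true]; decide
        · rw [Pi.add_apply, Pi.single_eq_of_ne hji, add_zero]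
          simp only [hji, iff_false]
          exact lettZ_ne_zero _
      rw [hfilter, Finset.prod_singleton, hai]
      rfl
    · have hc : ¬ Compatible a ((fun j => lettZ (a j)) + Pi.single i 1) := by
        intro hc
        rw [Bool.not_eq_true] at hai
        have h := hc i
        rw [Pi.add_apply, Pi.single_eq_same, hai, l1] at h
        exact absurd (h (by decide)) (by decide)
      rw [if_neg hc, if_neg hai]
  rw [h1, mul_one, Finset.sum_congr rfl fun i _ => h2 i, Finset.sum_ite, Finset.sum_const_zero, add_zero,
    Finset.sum_const]
  unfold nTwo
  rw [nsmul_eq_mul]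
  push_cast
  have h3 : ω * ω ^ 2 = 1 := by rw [← pow_succ', omega_pow_mod 3]; simp
  linear_combination ((univ.filter fun i => a i = true).card : F4) * h3

/-- `A_{k₀} ≠ 0` when `m` is odd. -/
theorem coefA_pattern_ne_zero (a : Fin m → Bool) (ε : ℕ) (hm : Odd m) :
    coefA a ε (fun i => lettZ (a i)) ≠ 0 := by
  rw [coefA_pattern]
  have hm1 : (m : F4) = 1 := by
    rw [natCast_eq, if_pos (Nat.odd_iff.mp hm)]
  rw [hm1, one_mul]
  exact ne_zero_of_isUnit (isUnit_natCast_add_omega _)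

/-- **`B_{k₀} = 0`**: `−δ_{k₀}` and every `−δ_{k₀} + e_i` are incompatible (`m ≥ 2`). -/
theorem coefA_neg_pattern (a : Fin m → Bool) (ε : ℕ) (hm : 2 ≤ m) :
    coefA a ε (-fun i => lettZ (a i)) = 0 := by
  have hm0 : 0 < m := by omega
  refine coefA_eq_zero_of_incompatible ε ?_ ?_
  · intro hc
    have h := hc ⟨0, hm0⟩ (by rw [Pi.neg_apply, neg_ne_zero]; exact lettZ_ne_zero _)
    rw [Pi.neg_apply] at h
    exact neg_lettZ_ne _ h
  · intro i hc
    -- a coordinate `j ≠ i`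
    obtain ⟨j, hji⟩ : ∃ j : Fin m, j ≠ i := by
      by_cases hi : i.val = 0
      · exact ⟨⟨1, by omega⟩, fun h => by rw [Fin.ext_iff] at h; simp at h; omega⟩
      · exact ⟨⟨0, hm0⟩, fun h => by rw [Fin.ext_iff] at h; simp at h; omega⟩
    have h := hc j (by
      rw [Pi.add_apply, Pi.neg_apply, Pi.single_eq_of_ne hji, add_zero, neg_ne_zero]; exact lettZ_ne_zero _)
    rw [Pi.add_apply, Pi.neg_apply, Pi.single_eq_of_ne hji, add_zero] at h
    exact neg_lettZ_ne _ h

/-- Outside the decimated set every coefficient vanishes: `¬ JCond a δ`, `δ ≠ 0` ⇒ `A(δ) = A(−δ) = 0`. -/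
theorem coefA_eq_zero_of_not_JCond {a : Fin m → Bool} (ε : ℕ) {δ : Fin m → ZMod 3} (hδ : δ ≠ 0)
    (hJ : ¬ JCond a δ) : coefA a ε δ = 0 ∧ coefA a ε (-δ) = 0 := by
  unfold JCond at hJ
  push Not at hJ
  obtain ⟨h1, h2, h3⟩ := hJ hδ
  exact ⟨coefA_eq_zero_of_incompatible ε h1 fun i => (h3 i).1,
    coefA_eq_zero_of_incompatible ε h2 fun i => (h3 i).2⟩

/-! ### The decoded tests and Lemma 37.D -/

/-- The decoded test `ψ(θ; A, B)(t) = tr(θ·(ω^t A + ω^{2t} B))`. -/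
def psi (θ A B : F4) (t : ZMod 3) : F4 := tr (θ * (ω ^ t.val * A + ω ^ (2 * t.val) * B))

/-- Decoded tests take values in `{0, 1}`. -/
theorem psi_cases (θ A B : F4) (t : ZMod 3) : psi θ A B t = 0 ∨ psi θ A B t = 1 := tr_cases _
/-- **Blind tests decode to `0`**: `ψ(θ; U, U) ≡ 0` when `θU = 1` (`ω^t + ω^{2t} = tr ω^t ∈ 𝔽₂`). -/
theorem psi_blind {θ U : F4} (hθ : θ * U = 1) (t : ZMod 3) : psi θ U U t = 0 := by
  unfold psi
  have e : θ * (ω ^ t.val * U + ω ^ (2 * t.val) * U) = tr (ω ^ t.val) := by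
    unfold tr
    rw [← pow_mul, mul_comm t.val 2]
    linear_combination (ω ^ t.val + ω ^ (2 * t.val)) * hθ
  rw [e, tr_tr]

/-- Vanishing coefficients decode to `0`. -/
theorem psi_zero_zero (θ : F4) (t : ZMod 3) : psi θ 0 0 t = 0 := by
  unfold psi; rw [mul_zero, mul_zero, add_zero, mul_zero, tr_zero]
/-- **Lemma 37.D (ii)**: a non-zero `A` with `B = 0` decodes to a GENUINE test (not constant), for `θ` a unit. -/
theorem psi_nonconst {θ A : F4} (hθ : IsUnit θ) (hA : A ≠ 0) : ∃ t t' : ZMod 3, psi θ A 0 t ≠ psi θ A 0 t' := by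
  have hc : θ * A ≠ 0 := by
    intro h
    obtain ⟨u, hu⟩ := hθ
    have : A = 0 := by
      calc A = (↑u⁻¹ * ↑u) * A := by rw [Units.inv_mul, one_mul]
        _ = ↑u⁻¹ * (θ * A) := by rw [hu, mul_assoc]
        _ = 0 := by rw [h, mul_zero]
    exact hA this
  obtain ⟨t, t', h⟩ := tr_mul_pow_nonconst hc
  refine ⟨t, t', ?_⟩
  unfold psi
  rw [mul_zero, add_zero, mul_zero, add_zero, ← mul_assoc, ← mul_assoc, mul_right_comm θ _ A, mul_right_comm θ _ A]
  exact h

/-- **Lemma 37.D (i)+(iii), the DECIMATION IDENTITY.**  If the fibre function `g_{ρ,b}` (`b ∈ 𝔽₂`) vanishes on the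
coset `H_ε`, then the decoded tests satisfy the PARITY RELATION `Σ_k ψ_k(ρ_k) = c₀ := tr(θC)` — for any `θ` with `θU = 1`. -/
theorem decimation_identity (a : Fin m → Bool) (ε : ℕ) (δ : Fin s → Fin m → ZMod 3) (T : Finset (Fin m))
    {θ : F4} (hθ : θ * coefU a ε = 1) (ρ : Fin s → ZMod 3) {b : F4} (hb : b = 0 ∨ b = 1)
    (hzero : ∀ w, gfun δ T ρ b w * cosetInd ε w = 0) :
    ∑ k, psi θ (coefA a ε (δ k)) (coefA a ε (-δ k)) (ρ k) = tr (θ * coefC a ε T) := by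
  have hL : Lfun a (fun w => gfun δ T ρ b w * cosetInd ε w) = 0 := by
    rw [show (fun w => gfun δ T ρ b w * cosetInd ε w) = fun _ => (0 : F4) from funext hzero]
    exact Lfun_zero_fun a
  rw [Lfun_gfun_mul_cosetInd] at hL
  have htr : tr (θ * ((∑ k, (ω ^ (ρ k).val * coefA a ε (δ k) + ω ^ (2 * (ρ k).val) * coefA a ε (-δ k))) +
      coefC a ε T + b * coefU a ε)) = 0 := by rw [hL, mul_zero, tr_zero]
  rw [mul_add, mul_add, tr_add, tr_add, Finset.mul_sum, tr_sum] at htr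
  have hbU : tr (θ * (b * coefU a ε)) = 0 := by
    rw [mul_left_comm, hθ, mul_one]
    rcases hb with rfl | rfl
    · exact tr_zero
    · exact tr_one
  rw [hbU, add_zero] at htr
  exact eq_of_add_eq_zero htr

open Classical in
/-- `θ := U⁻¹` (and `0` if `U` is not a unit — never used). -/
def theta (a : Fin m → Bool) (ε : ℕ) : F4 :=
  if h : IsUnit (coefU a ε) then ((h.unit⁻¹ : F4ˣ) : F4) else 0

/-- `θ U = 1` for `m` odd. -/
theorem theta_mul_coefU (a : Fin m → Bool) (ε : ℕ) (hm : Odd m) : theta a ε * coefU a ε = 1 := by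
  unfold theta
  rw [dif_pos (isUnit_coefU a ε hm)]
  exact (isUnit_coefU a ε hm).val_inv_mul

/-- `θ` is a unit for `m` odd. -/
theorem isUnit_theta (a : Fin m → Bool) (ε : ℕ) (hm : Odd m) : IsUnit (theta a ε) := by
  unfold theta
  rw [dif_pos (isUnit_coefU a ε hm)]
  exact Units.isUnit _

/-- **Tests outside the decimated set decode to `0`** (blind: `ψ(U,U) = 0`; incompatible: `ψ(0,0) = 0`). -/
theorem psi_eq_zero_of_not_JCond (a : Fin m → Bool) (ε : ℕ) (hm : Odd m) {δ : Fin m → ZMod 3}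
    (hJ : ¬ JCond a δ) (t : ZMod 3) : psi (theta a ε) (coefA a ε δ) (coefA a ε (-δ)) t = 0 := by
  by_cases hδ : δ = 0
  · subst hδ
    rw [neg_zero, coefA_zero]
    exact psi_blind (theta_mul_coefU a ε hm) t
  · obtain ⟨h1, h2⟩ := coefA_eq_zero_of_not_JCond ε hδ hJ
    rw [h1, h2]
    exact psi_zero_zero _ t

/-- **Lemma 37.D (ii)**: the dense test `k₀` (direction = the pattern `a` itself) decodes to a genuine test
(`m` odd, `m ≥ 2`). -/
theorem psi_pattern_nonconst (a : Fin m → Bool) (ε : ℕ) (hm : Odd m) (h2 : 2 ≤ m) :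
    ∃ t t' : ZMod 3, psi (theta a ε) (coefA a ε (fun i => lettZ (a i))) (coefA a ε (-fun i => lettZ (a i))) t ≠
      psi (theta a ε) (coefA a ε (fun i => lettZ (a i))) (coefA a ε (-fun i => lettZ (a i))) t' := by
  rw [coefA_neg_pattern a ε h2]
  exact psi_nonconst (isUnit_theta a ε hm) (coefA_pattern_ne_zero a ε hm)

end Summit.QuantumAdvantage.AdviceFreeQNC0.Exp37

end
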